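import Mathlib.Data.ZMod.Basic
import Mathlib.Data.Nat.Prime.Int
import Mathlib.RingTheory.Int.Basic
import Mathlib.RingTheory.PrincipalIdealDomain
import Mathlib.Data.Fintype.Card
import Mathlib.Tactic.Ring
import Mathlib.Tactic.LinearCombination
import Mathlib.Tactic.NormNum
import Mathlib.Tactic.NormNum.Prime
import HarnessLib

/-!
# Venture HSemireg — Hensel lifting for square roots modulo odd prime powers: `#{x ∈ ℤ∕p^{e+1} : x² = a} = #{x ∈ ℤ∕p^e : x² = a}` for
# `p` odd, `p ∤ a`, `e ≥ 1` — the prime-power half of «`2^{ω(d′)}`» (THEOREM 35-B, ENGINE-W PROBE5 §35 (3)) — kernel number theory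

HONEST FRAMING. Lean index of the computation cell `pub-hsemireg`, widening group ENGINE-W (code A, seat `engine-w-1`, gen 17).
ELEMENTARY NUMBER THEORY (Hensel's lemma for `x² − a`, odd `p`); no abelian variety, sheaf, `Ext` group, secant structure or
semiregularity map is constructed; nothing here says that HC, HC_CM or HC_AV holds. Theorems only (0 `def`, 0 named fact, 0 `sorry`).
New namespace `HenselSqrt`; companions `SquareRootCountCRT.lean` (coprime products) and `TargetResidueCounts.lean` (enumerations).

SOURCE (the cell's own result): `widen/ENGINE-W/out/probe5/PROBE5-STIZ-A.md` §35 (3) THEOREM 35-B: «The residues `A mod d` with `A² ≡ −2`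
number `2^{ω(d′)}` (`d′` = odd part of `d` …)» — for a prime power `ℓ^e ∥ d′` the count modulo `ℓ^e` equals the count modulo `ℓ` (two when
`(−2∕ℓ) = 1`); this file supplies that lifting step in general. What the kernel holds (integers first, then the count):

* §1 **`lift_exists`** — `p` prime, `p ∤ 2x`, `1 ≤ e`, `p^e ∣ x² − a` ⟹ `∃ y ≡ x (mod p^e)` with `p^{e+1} ∣ y² − a`;
  **`lift_unique`** — two such lifts `y, y′ ≡ x (mod p^e)` agree `mod p^{e+1}`; `not_dvd_two_mul` — for `p` odd, `p ∤ a` and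
  `p ∣ x² − a` give `p ∤ 2x`.
* §2 **`card_sqrt_succ`** — for `p` an odd prime, `p ∤ a`, `1 ≤ e`: `|{y : ℤ∕p^{e+1} // y² = a}| = |{x : ℤ∕p^e // x² = a}|` (reduction is a
  bijection), and **`card_sqrt_pow`** — hence `= |{x : ℤ∕p // x² = a}|` for every `e ≥ 1`; instances `9, 27, 81` for `a = −2` (`= 2`).
-/

namespace Summit.Ventures.HSemireg.HenselSqrt

/-! ## §1 The integer lifting lemmas -/

/-- For `p ∤ a` and `p ∣ x² − a`: `p ∤ x`; with `p` odd also `p ∤ 2x`. [kernel] -/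
theorem not_dvd_two_mul {p : ℕ} (hp : p.Prime) (hodd : p ≠ 2) {x a : ℤ} (ha : ¬ (p : ℤ) ∣ a) (hx : (p : ℤ) ∣ x ^ 2 - a) :
    ¬ (p : ℤ) ∣ 2 * x := by
  have hpZ : Prime (p : ℤ) := Nat.prime_iff_prime_int.1 hp
  intro h
  rcases hpZ.dvd_or_dvd h with h2 | hxp
  · -- p ∣ 2 forces p = 2
    have : (p : ℤ) ≤ 2 := Int.le_of_dvd (by norm_num) h2
    have hp2 : 2 ≤ p := hp.two_le
    omega
  · apply ha
    have hx2 : (p : ℤ) ∣ x ^ 2 := dvd_pow hxp two_ne_zero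
    have := (Dvd.dvd.sub hx2 hx : (p : ℤ) ∣ x ^ 2 - (x ^ 2 - a))  -- p ∣ x² − (x² − a) = a
    simpa using this

/-- **Existence of the lift**: `p^e ∣ x² − a`, `p ∤ 2x`, `1 ≤ e` ⟹ some `y ≡ x (mod p^e)` has `p^{e+1} ∣ y² − a`
(`y = x + t·p^e` with `2x·t ≡ −(x² − a)∕p^e (mod p)`). [kernel] -/
theorem lift_exists {p : ℕ} (hp : p.Prime) {x a : ℤ} {e : ℕ} (he : 1 ≤ e) (h2x : ¬ (p : ℤ) ∣ 2 * x)
    (hx : (p : ℤ) ^ e ∣ x ^ 2 - a) :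
    ∃ y : ℤ, (p : ℤ) ^ e ∣ y - x ∧ (p : ℤ) ^ (e + 1) ∣ y ^ 2 - a := by
  have hpZ : Prime (p : ℤ) := Nat.prime_iff_prime_int.1 hp
  obtain ⟨c, hc⟩ := hx
  -- Bezout: u·(2x) + v·p = 1
  have hcop : IsCoprime (2 * x) (p : ℤ) := ((Irreducible.coprime_iff_not_dvd hpZ.irreducible).2 h2x).symm
  obtain ⟨u, v, huv⟩ := hcop
  refine ⟨x + (-(c * u)) * (p : ℤ) ^ e, ⟨-(c * u), by ring⟩, ?_⟩
  -- (x + t p^e)² − a = p^e (c + 2 x t) + t² p^{2e},  c + 2xt = c(1 − 2xu) = c v p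
  have key : (x + (-(c * u)) * (p : ℤ) ^ e) ^ 2 - a
      = (p : ℤ) ^ (e + 1) * (c * v) + (p : ℤ) ^ (e + 1) * ((p : ℤ) ^ (e - 1) * (c * u) ^ 2) := by
    have hsplit : (p : ℤ) ^ e * (p : ℤ) ^ e = (p : ℤ) ^ (e + 1) * (p : ℤ) ^ (e - 1) := by
      rw [← pow_add, ← pow_add]; congr 1; omega
    have hx2 : x ^ 2 - a = (p : ℤ) ^ e * c := hc
    linear_combination hx2 + (c * u) ^ 2 * hsplit - ((p : ℤ) ^ e * c) * huv
  rw [key]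
  exact Dvd.dvd.add (dvd_mul_right _ _) (dvd_mul_right _ _)

/-- **Uniqueness of the lift**: if `p ∤ 2x`, `1 ≤ e`, and `y, y′ ≡ x (mod p^e)` both satisfy `p^{e+1} ∣ (·)² − a`, then
`y ≡ y′ (mod p^{e+1})` (`(y − y′)(y + y′)` with `y + y′ ≡ 2x ≢ 0 (mod p)`). [kernel] -/
theorem lift_unique {p : ℕ} (hp : p.Prime) {x a y y' : ℤ} {e : ℕ} (he : 1 ≤ e) (h2x : ¬ (p : ℤ) ∣ 2 * x)
    (hy : (p : ℤ) ^ (e + 1) ∣ y ^ 2 - a) (hy' : (p : ℤ) ^ (e + 1) ∣ y' ^ 2 - a)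
    (hyx : (p : ℤ) ^ e ∣ y - x) (hy'x : (p : ℤ) ^ e ∣ y' - x) : (p : ℤ) ^ (e + 1) ∣ y - y' := by
  have hpZ : Prime (p : ℤ) := Nat.prime_iff_prime_int.1 hp
  have hp0 : (p : ℤ) ≠ 0 := by exact_mod_cast hp.ne_zero
  -- y − y′ = p^e · s
  obtain ⟨s, hs⟩ : (p : ℤ) ^ e ∣ y - y' := by
    have := Dvd.dvd.sub hyx hy'x; simpa using this
  -- p^{e+1} ∣ y² − y′² = p^e·s·(y + y′)
  have hdiff : (p : ℤ) ^ (e + 1) ∣ (p : ℤ) ^ e * (s * (y + y')) := by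
    have h1 := Dvd.dvd.sub hy hy'
    have h2 : y ^ 2 - a - (y' ^ 2 - a) = (y - y') * (y + y') := by ring
    rw [h2, hs, mul_assoc] at h1
    exact h1
  rw [pow_succ] at hdiff
  have hps : (p : ℤ) ∣ s * (y + y') := (mul_dvd_mul_iff_left (pow_ne_zero e hp0)).1 hdiff
  -- p ∤ y + y′ (≡ 2x mod p)
  have hpe : (p : ℤ) ∣ (p : ℤ) ^ e := dvd_pow_self _ (by omega)
  have hsum : ¬ (p : ℤ) ∣ y + y' := by
    intro h
    apply h2x
    have h3 : (p : ℤ) ∣ (y - x) + (y' - x) := Dvd.dvd.add (hpe.trans hyx) (hpe.trans hy'x)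
    have h4 := Dvd.dvd.sub h h3
    have h5 : y + y' - (y - x + (y' - x)) = 2 * x := by ring
    rwa [h5] at h4
  rcases hpZ.dvd_or_dvd hps with h | h
  · rw [hs, pow_succ]
    exact mul_dvd_mul_left _ h
  · exact absurd h hsum

/-! ## §2 The count is stable under `p^e ↦ p^{e+1}` -/

/-- **Hensel count**: for an odd prime `p`, `p ∤ a` and `1 ≤ e`, reduction `ℤ∕p^{e+1} → ℤ∕p^e` is a bijection on the roots of
`x² = a`; hence the root counts agree. [kernel] -/
theorem card_sqrt_succ (p : ℕ) [hp : Fact p.Prime] (hodd : p ≠ 2) (a : ℤ) (ha : ¬ (p : ℤ) ∣ a) (e : ℕ) (he : 1 ≤ e) :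
    Fintype.card {y : ZMod (p ^ (e + 1)) // y ^ 2 = (a : ZMod (p ^ (e + 1)))}
      = Fintype.card {x : ZMod (p ^ e) // x ^ 2 = (a : ZMod (p ^ e))} := by
  have hdvd : p ^ e ∣ p ^ (e + 1) := pow_dvd_pow p (Nat.le_succ e)
  let π : ZMod (p ^ (e + 1)) →+* ZMod (p ^ e) := ZMod.castHom hdvd (ZMod (p ^ e))
  -- integer dictionary
  have root_int : ∀ (n : ℕ) [NeZero n] (Y : ℤ), ((Y : ZMod n) ^ 2 = (a : ZMod n)) ↔ ((n : ℤ) ∣ Y ^ 2 - a) := by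
    intro n _ Y
    rw [← Int.cast_pow, ZMod.intCast_eq_intCast_iff_dvd_sub]
    rw [dvd_sub_comm]
  have eq_int : ∀ (n : ℕ) [NeZero n] (Y Y' : ℤ), ((Y : ZMod n) = (Y' : ZMod n)) ↔ ((n : ℤ) ∣ Y' - Y) := by
    intro n _ Y Y'
    exact ZMod.intCast_eq_intCast_iff_dvd_sub Y Y' n
  -- the reduction map on roots
  let red : {y : ZMod (p ^ (e + 1)) // y ^ 2 = (a : ZMod (p ^ (e + 1)))} →
      {x : ZMod (p ^ e) // x ^ 2 = (a : ZMod (p ^ e))} :=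
    fun y => ⟨π y.1, by have h := congrArg π y.2; simpa [map_pow, map_intCast] using h⟩
  apply Fintype.card_of_bijective (f := red)
  constructor
  · -- injective
    rintro ⟨y₁, hy₁⟩ ⟨y₂, hy₂⟩ h
    obtain ⟨Y₁, rfl⟩ := ZMod.intCast_surjective y₁
    obtain ⟨Y₂, rfl⟩ := ZMod.intCast_surjective y₂
    have h' : ((Y₁ : ZMod (p ^ e))) = (Y₂ : ZMod (p ^ e)) := by
      have := congrArg Subtype.val h
      simpa [red, π, map_intCast] using this
    have hY₁ : ((p : ℤ)) ^ (e + 1) ∣ Y₁ ^ 2 - a := by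
      have := (root_int (p ^ (e + 1)) Y₁).1 hy₁; exact_mod_cast this
    have hY₂ : ((p : ℤ)) ^ (e + 1) ∣ Y₂ ^ 2 - a := by
      have := (root_int (p ^ (e + 1)) Y₂).1 hy₂; exact_mod_cast this
    have h12 : ((p : ℤ)) ^ e ∣ Y₂ - Y₁ := by
      have := (eq_int (p ^ e) Y₁ Y₂).1 h'; exact_mod_cast this
    have hp1 : (p : ℤ) ∣ Y₁ ^ 2 - a := (dvd_pow_self (p : ℤ) (by omega : e + 1 ≠ 0)).trans hY₁
    have h2x := not_dvd_two_mul hp.out hodd ha hp1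
    have key := lift_unique hp.out he h2x hY₁ hY₂ (by simp) h12
    apply Subtype.ext
    show (Y₁ : ZMod (p ^ (e + 1))) = Y₂
    rw [eq_int]
    have : ((p : ℤ)) ^ (e + 1) ∣ Y₂ - Y₁ := by
      have := Dvd.dvd.neg_right key; simpa using this
    exact_mod_cast this
  · -- surjective
    rintro ⟨x, hx⟩
    obtain ⟨X, rfl⟩ := ZMod.intCast_surjective x
    have hX : ((p : ℤ)) ^ e ∣ X ^ 2 - a := by
      have := (root_int (p ^ e) X).1 hx; exact_mod_cast this
    have hp1 : (p : ℤ) ∣ X ^ 2 - a := (dvd_pow_self (p : ℤ) (by omega : e ≠ 0)).trans hX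
    have h2x := not_dvd_two_mul hp.out hodd ha hp1
    obtain ⟨Y, hYX, hY⟩ := lift_exists hp.out he h2x hX
    refine ⟨⟨(Y : ZMod (p ^ (e + 1))), ?_⟩, ?_⟩
    · rw [root_int]; exact_mod_cast hY
    · apply Subtype.ext
      show π (Y : ZMod (p ^ (e + 1))) = (X : ZMod (p ^ e))
      rw [map_intCast, eq_int]
      have : ((p : ℤ)) ^ e ∣ X - Y := by
        have := Dvd.dvd.neg_right hYX; simpa using this
      exact_mod_cast this

/-- **Hence for every `e ≥ 1`**: `|{x ∈ ℤ∕p^e : x² = a}| = |{x ∈ ℤ∕p : x² = a}|` (odd `p ∤ a`). [kernel] -/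
theorem card_sqrt_pow (p : ℕ) [hp : Fact p.Prime] (hodd : p ≠ 2) (a : ℤ) (ha : ¬ (p : ℤ) ∣ a) :
    ∀ e, 1 ≤ e → Fintype.card {x : ZMod (p ^ e) // x ^ 2 = (a : ZMod (p ^ e))}
      = Fintype.card {x : ZMod (p ^ 1) // x ^ 2 = (a : ZMod (p ^ 1))} := by
  intro e he
  induction e, he using Nat.le_induction with
  | base => rfl
  | succ e he ih => rw [card_sqrt_succ p hodd a ha e he, ih]

/-- **Instances for `a = −2`, `p = 3`** (the prime powers `9, 27, 81` of the census, `(−2∕3) = 1`): two roots each. [kernel] -/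
theorem card_sqrt_three_powers :
    Fintype.card {x : ZMod (3 ^ 2) // x ^ 2 = ((-2 : ℤ) : ZMod (3 ^ 2))} = 2 ∧
    Fintype.card {x : ZMod (3 ^ 3) // x ^ 2 = ((-2 : ℤ) : ZMod (3 ^ 3))} = 2 ∧
    Fintype.card {x : ZMod (3 ^ 4) // x ^ 2 = ((-2 : ℤ) : ZMod (3 ^ 4))} = 2 := by
  haveI : Fact (Nat.Prime 3) := ⟨Nat.prime_three⟩
  have h3 : ¬ ((3 : ℕ) : ℤ) ∣ (-2 : ℤ) := by decide
  have base : Fintype.card {x : ZMod (3 ^ 1) // x ^ 2 = ((-2 : ℤ) : ZMod (3 ^ 1))} = 2 := by decide +kernel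
  refine ⟨?_, ?_, ?_⟩
  · rw [card_sqrt_pow 3 (by norm_num) (-2) h3 2 (by norm_num), base]
  · rw [card_sqrt_pow 3 (by norm_num) (-2) h3 3 (by norm_num), base]
  · rw [card_sqrt_pow 3 (by norm_num) (-2) h3 4 (by norm_num), base]

/-- And for `p = 11, 17, 19` (the other odd primes of record), e.g. the squares `121, 289, 361`: two roots. [kernel] -/
theorem card_sqrt_prime_squares :
    Fintype.card {x : ZMod (11 ^ 2) // x ^ 2 = ((-2 : ℤ) : ZMod (11 ^ 2))} = 2 ∧
    Fintype.card {x : ZMod (17 ^ 2) // x ^ 2 = ((-2 : ℤ) : ZMod (17 ^ 2))} = 2 ∧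
    Fintype.card {x : ZMod (19 ^ 2) // x ^ 2 = ((-2 : ℤ) : ZMod (19 ^ 2))} = 2 := by
  have b11 : Fintype.card {x : ZMod (11 ^ 1) // x ^ 2 = ((-2 : ℤ) : ZMod (11 ^ 1))} = 2 := by decide +kernel
  have b17 : Fintype.card {x : ZMod (17 ^ 1) // x ^ 2 = ((-2 : ℤ) : ZMod (17 ^ 1))} = 2 := by decide +kernel
  have b19 : Fintype.card {x : ZMod (19 ^ 1) // x ^ 2 = ((-2 : ℤ) : ZMod (19 ^ 1))} = 2 := by decide +kernel
  haveI : Fact (Nat.Prime 11) := ⟨by norm_num⟩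
  haveI : Fact (Nat.Prime 17) := ⟨by norm_num⟩
  haveI : Fact (Nat.Prime 19) := ⟨by norm_num⟩
  refine ⟨?_, ?_, ?_⟩
  · rw [card_sqrt_pow 11 (by norm_num) (-2) (by decide) 2 (by norm_num), b11]
  · rw [card_sqrt_pow 17 (by norm_num) (-2) (by decide) 2 (by norm_num), b17]
  · rw [card_sqrt_pow 19 (by norm_num) (-2) (by decide) 2 (by norm_num), b19]

end Summit.Ventures.HSemireg.HenselSqrt
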